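import Mathlib
import Literature.Combinatorics.Optimization.SheraliAdamsLocalDistributions
import HarnessLib

/-!
# Sherali–Adams solutions from locally positive semidefinite kernels by Gaussian sign rounding
# (Charikar–Makarychev–Makarychev 2009, Theorem 3.1, in Gram-matrix form)

[topic Combinatorics/Optimization]

Second file of the formalisation of the Charikar–Makarychev–Makarychev Sherali–Adams gap for
MAX-CUT (the tree's `CharikarMakarychevMakarychev2009_maxCutSA`).  CMM Theorem 3.1 (p. 6):

> **Theorem 3.1.** "Let `(X, ρ)` be a metric space. Assume that every `k = 2r + 3` points
> isometrically embed in the Euclidean sphere of radius `R`. Then the following solution belongs to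
> the Sherali–Adams relaxation of the cut polytope (with `r` rounds of lift-and-project):
> `x_ij = (1/π) arccos(1 − ρ(i,j)²/(2R²))`."  Proof: "Embed `T` in the sphere … Apply the MAX CUT
> algorithm of Goemans and Williamson: choose a random hyperplane passing through the origin … the
> distribution of cuts `D_T` is completely defined by all pairwise distances … since the pairwise
> distances uniquely determine the set of points on the sphere (up to an isometry of the whole
> sphere). Moreover, if `Q ⊂ T`, then the distribution of cuts `D_T` restricted to `Q` depends only
> on the distances between points in `Q`. Therefore, Lemma 2.1 applies."

**Gram-matrix rendering (recorded deviation of form, not of content).**  A finite point set on a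
sphere of radius `R` centred at the origin is, up to an isometry fixing the origin, the same thing as
its Gram matrix `G_ij = ⟨ψ(i), ψ(j)⟩ = R² − ρ(i,j)²/2`, a positive semidefinite matrix; and the cut
produced by a random hyperplane through the origin with standard Gaussian normal `g` is the sign
pattern of the centred Gaussian vector `(⟨g, ψ(i)⟩)_i`, whose covariance matrix is `G`.  We therefore
type the theorem for a KERNEL `K : [n] × [n] → ℝ` whose principal minors on the sets of size `≤ d`
are positive semidefinite ("every `d` points embed isometrically in a sphere"): the local
distribution `D_T` is the law of the sign pattern `(𝟙[Z_i ≥ 0])_{i ∈ T}` of `Z ~ N(0, K|_T)` (Mathlib's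
`ProbabilityTheory.multivariateGaussian 0 (K|_T)` on `EuclideanSpace ℝ T`), and the consistency
"`D_T` restricted to `Q` depends only on the distances in `Q`" is the marginalisation identity
`N(0, K|_T) ∘ (restriction to Q)⁻¹ = N(0, K|_Q)`
(`ProbabilityTheory.measurePreserving_restrict₂_multivariateGaussian`).  The value formula
`x_ij = arccos(⟨ψ_i,ψ_j⟩/R²)/π` is NOT derived (it needs the planar Gaussian angle computation); what
the MAX-CUT gap (Thm 5.3, "`x_ij = arccos(−1 + O(µ))/π = 1 − O(√µ) > 1 − ε/6`") uses is only that
almost antipodal points are separated with probability close to `1`, which is proved here in the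
elementary form: **if `K_ii = K_jj = 1` and `K_ij ≤ −1 + δ` with `δ ≤ ε³/16` then
`Pr[i, j separated] ≥ 1 − ε`** (anti-concentration of `Z_i ~ N(0,1)` on `(−ε/2, ε/2)` from the density
bound `(2π)^{−1/2} ≤ 1/2`, plus Chebyshev for `Z_i + Z_j`, whose variance is `2 + 2K_ij ≤ 2δ`).

Contents (namespace `GaussianSignRounding`):
* `localCov K T = K|_T`, `gauss K T = N(0, K|_T)`, `signPattern z = (𝟙[z_i ≥ 0])_i`, `cell`,
  `cellProb`, the local expectation functional `L K T F = Σ_b Pr[cell b] · F(b)`;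
* `sum_cellProb` (total mass `1`), `L_restrict` (consistency under `Q ⊆ T` from the Gaussian
  marginalisation), **`localExpectations K d hK : LocalExpectations n d`** — CMM Thm 3.1: a kernel
  whose `≤ d`-minors are PSD yields consistent local cut distributions on all sets of size `≤ d`,
  hence (previous file) a degree-`d` Sherali–Adams pseudoexpectation;
* `measure_sameSide_le` and **`saE_cutFn_ge`**: the Sherali–Adams value of the cut indicator of an
  edge `{u,v}` with `K_uv ≤ −1 + ε³/16` is `≥ 1 − ε`.

Everything is proved; no named facts.

## References

* [CharikarMakarychevMakarychev2009] M. Charikar, K. Makarychev, Y. Makarychev, *Integrality gaps for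
  Sherali–Adams relaxations*, STOC 2009, doi:10.1145/1536414.1536455; Thm 3.1 (p. 6), Thm 5.3 (p. 11).
  Held text `paper:doi-10-1145-1536414-1536455`.
* [GoemansWilliamson1995] M. X. Goemans, D. P. Williamson, *Improved approximation algorithms for
  maximum cut and satisfiability problems using semidefinite programming*, J. ACM 42 (1995) 1115–1145
  (random hyperplane rounding, as used in the printed proof).
-/

noncomputable section

open MeasureTheory ProbabilityTheory Finset Matrix Set
open scoped ENNReal NNReal

namespace Literature.Combinatorics.Optimization

namespace GaussianSignRounding

variable {n : ℕ} (K : Matrix (Fin n) (Fin n) ℝ)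

/-! ### The local Gaussian measures and the sign-pattern cells -/

/-- The principal minor `K|_T` of the kernel on the set `T` (the Gram matrix of the local sphere
embedding). [cite: CharikarMakarychevMakarychev2009, Thm 3.1 (p. 6)] -/
def localCov (T : Finset (Fin n)) : Matrix ↥T ↥T ℝ := K.submatrix Subtype.val Subtype.val

/-- Unfolding `localCov`. [cite: CharikarMakarychevMakarychev2009, Thm 3.1 (p. 6)] -/
@[simp] theorem localCov_apply (T : Finset (Fin n)) (i j : ↥T) : localCov K T i j = K i j := rfl

/-- The local Gaussian measure `N(0, K|_T)` on `ℝ^T` — the law of `(⟨g, ψ(i)⟩)_{i∈T}` for a standard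
Gaussian hyperplane normal `g` and the sphere embedding `ψ` with Gram matrix `K|_T`.
[cite: CharikarMakarychevMakarychev2009, Thm 3.1 proof (p. 6, "Choose a random hyperplane passing through the origin")] -/
def gauss (T : Finset (Fin n)) : Measure (EuclideanSpace ℝ ↥T) := multivariateGaussian 0 (localCov K T)

/-- The local Gaussian measure is a Gaussian measure. [folklore] -/
instance isGaussian_gauss (T : Finset (Fin n)) : IsGaussian (gauss K T) := by
  unfold gauss; infer_instance

/-- The local Gaussian measure is a probability measure. [folklore] -/
instance isProbabilityMeasure_gauss (T : Finset (Fin n)) : IsProbabilityMeasure (gauss K T) := by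
  infer_instance

/-- The side of the hyperplane: the sign pattern `(𝟙[z_i ≥ 0])_{i ∈ T}` of a point of `ℝ^T` (the cut
"vertices lying on one side of the hyperplane"). [cite: CharikarMakarychevMakarychev2009, Thm 3.1 proof (p. 6)] -/
def signPattern {T : Finset (Fin n)} (z : EuclideanSpace ℝ ↥T) : ↥T → Bool := fun i => decide (0 ≤ z i)

/-- The cell of the local assignment `b`: the points of `ℝ^T` with sign pattern `b`.
[cite: CharikarMakarychevMakarychev2009, Thm 3.1 proof (p. 6)] -/
def cell (T : Finset (Fin n)) (b : ↥T → Bool) : Set (EuclideanSpace ℝ ↥T) := signPattern ⁻¹' {b}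

/-- Coordinates of `ℝ^T` are measurable. [folklore] -/
private theorem measurable_apply' {T : Finset (Fin n)} (i : ↥T) :
    Measurable fun z : EuclideanSpace ℝ ↥T => z i := by
  fun_prop

/-- The sign pattern is a measurable map (into the finite discrete space `{0,1}^T`). [cite: CharikarMakarychevMakarychev2009, Thm 3.1 proof (p. 6)] -/
theorem measurable_signPattern (T : Finset (Fin n)) :
    Measurable (signPattern (T := T)) := by
  refine measurable_pi_iff.2 fun i => ?_
  refine measurable_to_countable' fun b => ?_
  have hle : MeasurableSet {z : EuclideanSpace ℝ ↥T | 0 ≤ z i} :=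
    measurableSet_le measurable_const (measurable_apply' i)
  cases b
  · convert hle.compl using 1
    ext z; simp [signPattern]
  · convert hle using 1
    ext z; simp [signPattern]

/-- Cells are measurable. [cite: CharikarMakarychevMakarychev2009, Thm 3.1 proof (p. 6)] -/
theorem measurableSet_cell (T : Finset (Fin n)) (b : ↥T → Bool) : MeasurableSet (cell T b) :=
  measurable_signPattern T (MeasurableSet.singleton b)

/-- The probability of the cell `b` under `N(0, K|_T)`: `D_T({b})`.
[cite: CharikarMakarychevMakarychev2009, Thm 3.1 proof (p. 6, "the distribution of cuts D_T")] -/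
def cellProb (T : Finset (Fin n)) (b : ↥T → Bool) : ℝ := ((gauss K T) (cell T b)).toReal

/-- Cell probabilities are nonnegative. [cite: CharikarMakarychevMakarychev2009, Thm 3.1 proof (p. 6)] -/
theorem cellProb_nonneg (T : Finset (Fin n)) (b : ↥T → Bool) : 0 ≤ cellProb K T b :=
  ENNReal.toReal_nonneg

/-- Summing cell probabilities over a set of patterns gives the probability of the union of cells.
[cite: CharikarMakarychevMakarychev2009, Thm 3.1 proof (p. 6)] -/
theorem sum_cellProb_eq (T : Finset (Fin n)) (s : Finset (↥T → Bool)) :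
    ∑ b ∈ s, cellProb K T b = ((gauss K T) (signPattern ⁻¹' (s : Set (↥T → Bool)))).toReal := by
  unfold cellProb cell
  rw [← ENNReal.toReal_sum fun b _ => measure_ne_top _ _,
    sum_measure_preimage_singleton s fun b _ => measurableSet_cell T b]

/-- **Total mass**: `Σ_b D_T({b}) = 1`. [cite: CharikarMakarychevMakarychev2009, Thm 3.1 proof (p. 6)] -/
theorem sum_cellProb (T : Finset (Fin n)) : ∑ b, cellProb K T b = 1 := by
  rw [sum_cellProb_eq, coe_univ, preimage_univ, measure_univ, ENNReal.toReal_one]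

/-! ### The local expectation functionals and their consistency -/

/-- The local expectation functional `L_T F = E_{D_T} F = Σ_b D_T({b}) F(b)` of the Gaussian sign
rounding on `T`. [cite: CharikarMakarychevMakarychev2009, Thm 3.1 proof (p. 6)] -/
def L (T : Finset (Fin n)) : ((↥T → Bool) → ℝ) →ₗ[ℝ] ℝ where
  toFun F := ∑ b, cellProb K T b * F b
  map_add' F G := by simp only [Pi.add_apply, mul_add, sum_add_distrib]
  map_smul' a F := by simp only [Pi.smul_apply, smul_eq_mul, RingHom.id_apply, mul_sum, mul_left_comm]

/-- Unfolding `L`. [cite: CharikarMakarychevMakarychev2009, Thm 3.1 proof (p. 6)] -/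
theorem L_apply (T : Finset (Fin n)) (F : (↥T → Bool) → ℝ) : L K T F = ∑ b, cellProb K T b * F b := rfl

/-- `L_T` is nonnegative on nonnegative functions. [cite: CharikarMakarychevMakarychev2009, Thm 3.1 proof (p. 6)] -/
theorem L_nonneg (T : Finset (Fin n)) (F : (↥T → Bool) → ℝ) (hF : ∀ b, 0 ≤ F b) : 0 ≤ L K T F :=
  sum_nonneg fun b _ => mul_nonneg (cellProb_nonneg K T b) (hF b)

/-- `L_T 1 = 1`. [cite: CharikarMakarychevMakarychev2009, Thm 3.1 proof (p. 6)] -/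
theorem L_one (T : Finset (Fin n)) : L K T (fun _ => 1) = 1 := by
  simp [L_apply, sum_cellProb]

/-- The value of `L_T` on the indicator of a set of patterns is the Gaussian measure of the union of
the corresponding cells. [cite: CharikarMakarychevMakarychev2009, Thm 3.1 proof (p. 6)] -/
theorem L_indicator (T : Finset (Fin n)) (s : Finset (↥T → Bool)) :
    L K T (fun b => if b ∈ s then 1 else 0) =
      ((gauss K T) (signPattern ⁻¹' (s : Set (↥T → Bool)))).toReal := by
  rw [L_apply, ← sum_cellProb_eq]
  simp only [mul_ite, mul_one, mul_zero]
  rw [sum_ite_mem, Finset.univ_inter]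

/-- Restriction of coordinates commutes with taking sign patterns. [folklore] -/
private theorem signPattern_restrict₂ {Q T : Finset (Fin n)} (h : Q ⊆ T) (z : EuclideanSpace ℝ ↥T) :
    signPattern (EuclideanSpace.restrict₂ h z) = Finset.restrict₂ (π := fun _ => Bool) h (signPattern z) :=
  rfl

/-- The `Q`-minor of the `T`-minor is the `Q`-minor. [folklore] -/
private theorem localCov_submatrix {Q T : Finset (Fin n)} (h : Q ⊆ T) :
    (localCov K T).submatrix (fun i : ↥Q => (⟨i.1, h i.2⟩ : ↥T)) (fun i : ↥Q => (⟨i.1, h i.2⟩ : ↥T)) =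
      localCov K Q := rfl

/-- **Gaussian marginalisation** ("the distribution of cuts `D_T` restricted to `Q` depends only on
the distances between points in `Q`"): restriction `ℝ^T → ℝ^Q` pushes `N(0, K|_T)` to `N(0, K|_Q)`.
[cite: CharikarMakarychevMakarychev2009, Thm 3.1 proof (p. 6)] -/
theorem measurePreserving_restrict {Q T : Finset (Fin n)} (h : Q ⊆ T) (hT : (localCov K T).PosSemidef) :
    MeasurePreserving (EuclideanSpace.restrict₂ h) (gauss K T) (gauss K Q) := by
  have := measurePreserving_restrict₂_multivariateGaussian (μ := (0 : EuclideanSpace ℝ ↥T)) hT h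
  simpa [gauss, localCov_submatrix] using this

/-- **Consistency of the local cut distributions** (`D_Q({A}) = D_T({B : B ∩ Q = A})`, in functional
form): `L_T (F ∘ restrict) = L_Q F` for `Q ⊆ T`, when `K|_T ⪰ 0`.
[cite: CharikarMakarychevMakarychev2009, Thm 3.1 proof (p. 6) and Lemma 2.1 (p. 5)] -/
theorem L_restrict {Q T : Finset (Fin n)} (h : Q ⊆ T) (hT : (localCov K T).PosSemidef)
    (F : (↥Q → Bool) → ℝ) :
    L K T (fun b => F (Finset.restrict₂ (π := fun _ => Bool) h b)) = L K Q F := by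
  classical
  rw [L_apply, L_apply]
  -- group the patterns on `T` by their restriction to `Q`
  rw [← Finset.sum_fiberwise_of_maps_to (g := fun b : ↥T → Bool => Finset.restrict₂ (π := fun _ => Bool) h b)
    (s := univ) (t := univ) fun _ _ => mem_univ _]
  refine sum_congr rfl fun a _ => ?_
  have hfib : ∀ b ∈ univ.filter (fun b : ↥T → Bool => Finset.restrict₂ (π := fun _ => Bool) h b = a),
      cellProb K T b * F (Finset.restrict₂ (π := fun _ => Bool) h b) = cellProb K T b * F a := by
    intro b hb
    rw [(mem_filter.1 hb).2]
  rw [sum_congr rfl hfib, ← sum_mul, sum_cellProb_eq]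
  congr 2
  -- the union of the `T`-cells over the fibre of `a` is the preimage of the `Q`-cell of `a`
  have hpre : signPattern ⁻¹' ((univ.filter fun b : ↥T → Bool =>
      Finset.restrict₂ (π := fun _ => Bool) h b = a : Finset (↥T → Bool)) : Set (↥T → Bool)) =
      EuclideanSpace.restrict₂ h ⁻¹' cell Q a := by
    ext z
    simp [cell, signPattern_restrict₂]
  rw [hpre, (measurePreserving_restrict K h hT).measure_preimage (measurableSet_cell Q a).nullMeasurableSet]

/-- **CMM Theorem 3.1 (Gram form): a kernel whose principal minors on the sets of size `≤ d` are
positive semidefinite yields a consistent family of local cut distributions on all sets of size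
`≤ d`** — the Gaussian sign rounding (random hyperplane) of the local Gram configurations — and hence,
by Lemma 2.1 (`LocalExpectations.toSA`), a degree-`d` Sherali–Adams pseudoexpectation.
[cite: CharikarMakarychevMakarychev2009, Thm 3.1 (p. 6)] -/
def localExpectations (d : ℕ) (hK : ∀ T : Finset (Fin n), T.card ≤ d → (localCov K T).PosSemidef) :
    LocalExpectations n d where
  L T := L K T
  nonneg T _ F hF := L_nonneg K T F hF
  map_one T _ := L_one K T
  consistent _ _ h hT F := L_restrict K h (hK _ hT) F

/-- The functionals of `localExpectations` are the `L K T`. [cite: CharikarMakarychevMakarychev2009, Thm 3.1 (p. 6)] -/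
@[simp] theorem localExpectations_L (d : ℕ) (hK : ∀ T : Finset (Fin n), T.card ≤ d → (localCov K T).PosSemidef)
    (T : Finset (Fin n)) : (localExpectations K d hK).L T = L K T := rfl

/-! ### Almost antipodal pairs are almost surely separated -/

section Pair

variable {T : Finset (Fin n)} (u v : ↥T)

/-- The event "`u` and `v` on the same side of the hyperplane". [cite: CharikarMakarychevMakarychev2009, Thm 3.1 proof (p. 6)] -/
def sameSide : Set (EuclideanSpace ℝ ↥T) := {z | decide (0 ≤ z u) = decide (0 ≤ z v)}

/-- If `u, v` are on the same side and `|z_u| ≥ t` then `|z_u + z_v| ≥ t`: the same-side event is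
covered by `{|z_u| < t} ∪ {|z_u + z_v| ≥ t}`. [cite: CharikarMakarychevMakarychev2009, Thm 5.3 proof (p. 11)] -/
theorem sameSide_subset (t : ℝ) :
    sameSide u v ⊆ {z | |z u| < t} ∪ {z | t ≤ |z u + z v|} := by
  intro z hz
  simp only [sameSide, mem_setOf_eq, decide_eq_decide] at hz
  by_cases ht : |z u| < t
  · exact Or.inl ht
  · right
    simp only [mem_setOf_eq, not_lt] at ht ⊢
    refine ht.trans ?_
    by_cases hu : 0 ≤ z u
    · have hv : 0 ≤ z v := hz.1 hu
      rw [abs_of_nonneg hu, abs_of_nonneg (add_nonneg hu hv)]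
      linarith
    · have hv : ¬ 0 ≤ z v := fun hv => hu (hz.2 hv)
      push Not at hu hv
      rw [abs_of_neg hu, abs_of_neg (by linarith)]
      linarith

/-- **Anti-concentration of a standard Gaussian coordinate**: if `K_uu = 1` then
`Pr[|Z_u| < t] ≤ t` (density `≤ (2π)^{−1/2} ≤ 1/2` on an interval of length `2t`).
[cite: CharikarMakarychevMakarychev2009, Thm 5.3 proof (p. 11, the estimate of `x_ij`)] -/
theorem measure_abs_lt_le (hT : (localCov K T).PosSemidef) (huu : K u u = 1) (t : ℝ) :
    (gauss K T) {z | |z u| < t} ≤ ENNReal.ofReal t := by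
  have hmp := measurePreserving_eval_multivariateGaussian (μ := (0 : EuclideanSpace ℝ ↥T)) hT (i := u)
  have h1 : ((localCov K T) u u).toNNReal = 1 := by simp [huu]
  rw [h1] at hmp
  have hset : {z : EuclideanSpace ℝ ↥T | |z u| < t} = (fun z : EuclideanSpace ℝ ↥T => z u) ⁻¹' Ioo (-t) t := by
    ext z; simp [abs_lt]
  rw [gauss, hset, hmp.measure_preimage measurableSet_Ioo.nullMeasurableSet]
  simp only [PiLp.zero_apply]
  rw [gaussianReal_apply _ one_ne_zero]
  calc ∫⁻ x in Ioo (-t) t, gaussianPDF 0 1 x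
      ≤ ∫⁻ _ in Ioo (-t) t, ENNReal.ofReal (1 / 2) := by
        refine lintegral_mono fun x => ?_
        rw [gaussianPDF, gaussianPDFReal]
        refine ENNReal.ofReal_le_ofReal ?_
        have hexp : Real.exp (-(x - 0) ^ 2 / (2 * ((1 : ℝ≥0) : ℝ))) ≤ 1 :=
          Real.exp_le_one_iff.2 (by
            simp only [NNReal.coe_one, mul_one, sub_zero]
            exact div_nonpos_of_nonpos_of_nonneg (neg_nonpos.2 (sq_nonneg x)) (by norm_num))
        have hsqrt : (2 : ℝ) ≤ Real.sqrt (2 * Real.pi * ((1 : ℝ≥0) : ℝ)) := by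
          rw [NNReal.coe_one, mul_one]
          refine Real.le_sqrt_of_sq_le ?_   -- actually `Real.le_sqrt` style
          nlinarith [Real.pi_gt_three]
        have hinv : (Real.sqrt (2 * Real.pi * ((1 : ℝ≥0) : ℝ)))⁻¹ ≤ 1 / 2 := by
          rw [one_div]
          exact inv_anti₀ (by norm_num) hsqrt
        calc (Real.sqrt (2 * Real.pi * ((1 : ℝ≥0) : ℝ)))⁻¹ * Real.exp (-(x - 0) ^ 2 / (2 * ((1 : ℝ≥0) : ℝ)))
            ≤ 1 / 2 * 1 := mul_le_mul hinv hexp (Real.exp_nonneg _) (by norm_num)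
          _ = 1 / 2 := by ring
    _ = ENNReal.ofReal (1 / 2) * volume (Ioo (-t) t) := setLIntegral_const _ _
    _ = ENNReal.ofReal t := by
        rw [Real.volume_Ioo, ← ENNReal.ofReal_mul (by norm_num)]
        congr 1; ring

/-- **Chebyshev for `Z_u + Z_v`**: if `K_uu = K_vv = 1` and `K_uv ≤ −1 + δ` then
`Pr[|Z_u + Z_v| ≥ t] ≤ 2δ/t²` (`Var(Z_u + Z_v) = 2 + 2K_uv ≤ 2δ`).
[cite: CharikarMakarychevMakarychev2009, Thm 5.3 proof (p. 11, the estimate of `x_ij`)] -/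
theorem measure_abs_add_ge_le (hT : (localCov K T).PosSemidef) (huu : K u u = 1) (hvv : K v v = 1)
    {δ : ℝ} (huv : K u v ≤ -1 + δ) {t : ℝ} (ht : 0 < t) :
    (gauss K T) {z | t ≤ |z u + z v|} ≤ ENNReal.ofReal (2 * δ / t ^ 2) := by
  -- the random variable `Z_u + Z_v` as a continuous linear functional
  have hmu : MemLp (fun z : EuclideanSpace ℝ ↥T => z u) 2 (gauss K T) := by
    have := IsGaussian.memLp_dual (gauss K T) (EuclideanSpace.proj u) 2 (by norm_num)
    unfold gauss at this ⊢; simpa using this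
  have hmv : MemLp (fun z : EuclideanSpace ℝ ↥T => z v) 2 (gauss K T) := by
    have := IsGaussian.memLp_dual (gauss K T) (EuclideanSpace.proj v) 2 (by norm_num)
    unfold gauss at this ⊢; simpa using this
  have hmean : (gauss K T)[fun z : EuclideanSpace ℝ ↥T => z u + z v] = 0 := by
    rw [integral_add (hmu.integrable (by norm_num)) (hmv.integrable (by norm_num))]
    have hi : ∀ i : ↥T, ∫ z, (z : EuclideanSpace ℝ ↥T) i ∂(gauss K T) = 0 := by
      intro i
      have := (EuclideanSpace.proj (𝕜 := ℝ) i).integral_comp_comm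
        (IsGaussian.integrable_id (μ := gauss K T))
      simp only [EuclideanSpace.coe_proj, id_eq] at this
      rw [this]
      unfold gauss
      rw [integral_id_multivariateGaussian]
      rfl
    rw [hi u, hi v, add_zero]
  have hvar : Var[fun z : EuclideanSpace ℝ ↥T => z u + z v; gauss K T] = K u u + 2 * K u v + K v v := by
    rw [variance_fun_add hmu hmv]
    unfold gauss
    rw [variance_eval_multivariateGaussian hT, variance_eval_multivariateGaussian hT,
      covariance_eval_multivariateGaussian hT]
    rfl
  have hm : MemLp (fun z : EuclideanSpace ℝ ↥T => z u + z v) 2 (gauss K T) := hmu.add hmv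
  have hcheb := meas_ge_le_variance_div_sq hm ht
  rw [hmean] at hcheb
  simp only [sub_zero] at hcheb
  refine hcheb.trans (ENNReal.ofReal_le_ofReal (div_le_div_of_nonneg_right ?_ (by positivity)))
  rw [hvar, huu, hvv]
  linarith

/-- **Almost antipodal points are separated almost surely**: if `K_uu = K_vv = 1`, `K_uv ≤ −1 + δ`
and `δ ≤ ε³/16` (`0 < ε`), then `Pr[u, v on the same side] ≤ ε` (take `t = ε/2`:
`ε/2 + 2δ/(ε/2)² ≤ ε`).  This replaces the printed value `arccos(−1 + O(µ))/π = 1 − O(√µ)`.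
[cite: CharikarMakarychevMakarychev2009, Thm 5.3 proof (p. 11)] -/
theorem measure_sameSide_le (hT : (localCov K T).PosSemidef) (huu : K u u = 1) (hvv : K v v = 1)
    {δ ε : ℝ} (huv : K u v ≤ -1 + δ) (hε : 0 < ε) (hδ : δ ≤ ε ^ 3 / 16) :
    ((gauss K T) (sameSide u v)).toReal ≤ ε := by
  -- WLOG `δ ≥ 0` (replace `δ` by `max δ 0`)
  wlog hδ0 : 0 ≤ δ generalizing δ
  · exact this (huv.trans (by gcongr; exact le_max_left δ 0)) (max_le hδ (by positivity))
      (le_max_right δ 0)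
  have ht : (0 : ℝ) < ε / 2 := by positivity
  calc ((gauss K T) (sameSide u v)).toReal
      ≤ ((gauss K T) ({z | |z u| < ε / 2} ∪ {z | ε / 2 ≤ |z u + z v|})).toReal :=
        ENNReal.toReal_mono (measure_ne_top _ _) (measure_mono (sameSide_subset u v (ε / 2)))
    _ ≤ ((gauss K T) {z | |z u| < ε / 2}).toReal + ((gauss K T) {z | ε / 2 ≤ |z u + z v|}).toReal := by
        rw [← ENNReal.toReal_add (measure_ne_top _ _) (measure_ne_top _ _)]
        exact ENNReal.toReal_mono (by simp [measure_ne_top]) (measure_union_le _ _)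
    _ ≤ ε / 2 + 2 * δ / (ε / 2) ^ 2 := by
        gcongr
        · calc ((gauss K T) {z | |z u| < ε / 2}).toReal ≤ (ENNReal.ofReal (ε / 2)).toReal :=
                ENNReal.toReal_mono ENNReal.ofReal_ne_top (measure_abs_lt_le K u hT huu (ε / 2))
            _ = ε / 2 := ENNReal.toReal_ofReal ht.le
        · calc ((gauss K T) {z | ε / 2 ≤ |z u + z v|}).toReal
              ≤ (ENNReal.ofReal (2 * δ / (ε / 2) ^ 2)).toReal :=
                ENNReal.toReal_mono ENNReal.ofReal_ne_top (measure_abs_add_ge_le K u v hT huu hvv huv ht)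
            _ = 2 * δ / (ε / 2) ^ 2 := ENNReal.toReal_ofReal (by positivity)
    _ ≤ ε / 2 + ε / 2 := by
        have h3 : 2 * δ / (ε / 2) ^ 2 ≤ ε / 2 := by
          rw [div_le_iff₀ (by positivity)]
          nlinarith
        linarith
    _ = ε := by ring

/-- The same-side event in terms of sign patterns. [folklore] -/
private theorem sameSide_eq_preimage : sameSide u v =
    signPattern ⁻¹' ((univ.filter fun b : ↥T → Bool => b u = b v : Finset (↥T → Bool)) : Set (↥T → Bool)) := by
  ext z
  simp [sameSide, signPattern]

/-- **The local separation probability of an almost antipodal pair is close to `1`**: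
`L_T(𝟙[b_u ≠ b_v]) ≥ 1 − ε` under the hypotheses of `measure_sameSide_le`.
[cite: CharikarMakarychevMakarychev2009, Thm 5.3 proof (p. 11, "x_ij … > 1 − ε/6")] -/
theorem L_separated_ge (hT : (localCov K T).PosSemidef) (huu : K u u = 1) (hvv : K v v = 1)
    {δ ε : ℝ} (huv : K u v ≤ -1 + δ) (hε : 0 < ε) (hδ : δ ≤ ε ^ 3 / 16) :
    1 - ε ≤ L K T (fun b => if b u != b v then 1 else 0) := by
  have hsame : L K T (fun b => if b u = b v then (1 : ℝ) else 0) ≤ ε := by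
    have := L_indicator K T (univ.filter fun b : ↥T → Bool => b u = b v)
    simp only [mem_filter, Finset.mem_univ, true_and] at this
    rw [this, ← sameSide_eq_preimage]
    exact measure_sameSide_le K u v hT huu hvv huv hε hδ
  have hsplit : L K T (fun b => if b u != b v then (1 : ℝ) else 0) =
      L K T (fun _ => 1) - L K T (fun b => if b u = b v then (1 : ℝ) else 0) := by
    rw [← map_sub]
    congr 1
    funext b
    by_cases h : b u = b v <;> simp [h]
  rw [hsplit, L_one]
  linarith

end Pair

/-! ### The Sherali–Adams value of an edge -/

/-- **The Sherali–Adams value of the cut indicator of an almost antipodal edge is close to `1`**: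
for the pseudoexpectation of the Gaussian sign rounding of a kernel with PSD `≤ d`-minors (`d ≥ 2`),
`Ẽ[𝟙_{x_u ≠ x_v}] ≥ 1 − ε` whenever `K_uu = K_vv = 1` and `K_uv ≤ −1 + ε³/16`.
[cite: CharikarMakarychevMakarychev2009, Thm 3.1 (p. 6) and Thm 5.3 proof (p. 11)] -/
theorem saE_cutFn_ge {d : ℕ} (hK : ∀ T : Finset (Fin n), T.card ≤ d → (localCov K T).PosSemidef)
    (hd : 2 ≤ d) {u v : Fin n} (huv0 : u ≠ v) (huu : K u u = 1) (hvv : K v v = 1)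
    {δ ε : ℝ} (huv : K u v ≤ -1 + δ) (hε : 0 < ε) (hδ : δ ≤ ε ^ 3 / 16) :
    1 - ε ≤ (localExpectations K d hK).saE (cutFn s(u, v)) := by
  classical
  set T : Finset (Fin n) := {u, v} with hTdef
  have hT : T.card ≤ d := by
    rw [hTdef, card_pair huv0]; exact hd
  rw [(localExpectations K d hK).saE_eq_of_dependsOn hT (cutFn_dependsOn u v), localExpectations_L]
  have hu : u ∈ T := by simp [hTdef]
  have hv : v ∈ T := by simp [hTdef]
  have key := L_separated_ge K (T := T) ⟨u, hu⟩ ⟨v, hv⟩ (hK T hT) huu hvv huv hε hδ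
  convert key using 2
  funext b
  simp [cutFn, LocalExpectations.extend, hu, hv]

end GaussianSignRounding

end Literature.Combinatorics.Optimization

end
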